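import Mathlib
import Literature.NumberTheory.Transcendental.KZCubicalCalculus
import Literature.NumberTheory.Transcendental.KZLogCalculusProofs

/-!
# Crux `TateFamilyKernel` (stmt-KontsevichZagierPeriods-9130), line `Sketch` — stub `stub_dimZero`

Base case `n = 0` of the induction on the dimension in the lead's skeleton for the crux
`Summit.KontsevichZagierPeriods.KontsevichZagierPeriods.Theses.InverseLandau.TateFamilyKernel`
(tame-fibre form).  For a `0`-dimensional Tate family `P/Q` the cube `(0,1)⁰ ⊆ ℝ⁰` is the
one-point space `Fin 0 → ℝ` and Lebesgue measure gives it mass `1` (`Real.volume_pi_Ioo`, empty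
product), so the identical vanishing of `ϖ ↦ ∫_{(0,1)⁰} P(z,ϖ)/Q(z,ϖ) dz` on `(0,ε)` says exactly
that the fibre integrand `P(·,ϖ₀)/Q(·,ϖ₀)` vanishes at the unique point, hence on the domain
`KZ.cube 0` of any tame cube representation `Φ` of it; a representation whose integrand vanishes
on its domain is a relation (`KZ.of_mem_relations_of_eqOn_zero`).  The Tate normalisation, the
admissibility and the algebraicity hypotheses are not used in dimension `0`.
-/

noncomputable section

open MeasureTheory Set MvPolynomial
open Literature.NumberTheory.Transcendental

namespace Summit.KontsevichZagierPeriods.InverseLandau.TateFamilyKernel.Descent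

/-- The open unit cube `(0,1)⁰ ⊆ ℝ⁰` has Lebesgue measure `1` (empty product). [folklore] -/
theorem volume_pi_univ_Ioo_fin_zero :
    volume (Set.pi Set.univ fun _ : Fin 0 => Ioo (0 : ℝ) 1) = 1 := by
  rw [Real.volume_pi_Ioo]
  simp

/-- On the one-point space `ℝ⁰ = (Fin 0 → ℝ)` the integral over `(0,1)⁰` is evaluation at the
unique point. [folklore] -/
theorem setIntegral_pi_univ_Ioo_fin_zero (g : (Fin 0 → ℝ) → ℝ) :
    ∫ z in Set.pi Set.univ (fun _ : Fin 0 => Ioo (0 : ℝ) 1), g z = g default := by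
  have hg : g = fun _ => g default := funext fun z => by rw [Subsingleton.elim z default]
  rw [hg, setIntegral_const, measureReal_def, volume_pi_univ_Ioo_fin_zero]
  simp

/-- **Dimension `0`** of the crux `TateFamilyKernel` in tame-fibre form: if the `0`-dimensional
family `ϖ ↦ ∫_{(0,1)⁰} P(z,ϖ)/Q(z,ϖ) dz = P(ϖ)/Q(ϖ)` vanishes identically on `(0,ε)`, then at every
`ϖ₀ ∈ (0,ε)` the fibre integrand vanishes at the unique point of `ℝ⁰`, so every tame cube
representation `Φ` of the fibre has zero integrand on its domain `KZ.cube 0` and is a relation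
(`KZ.of_mem_relations_of_eqOn_zero`). [cite: KontsevichZagier2001, §1.2] -/
theorem stub_dimZero :
    ∀ (P Q : MvPolynomial (Fin (0 + 1)) ℚ) (ε : ℝ), 0 < ε →
      (∃ c₀ : ℚ, c₀ ≠ 0 ∧ ∀ z : Fin 0 → ℝ,
        aeval (Fin.snoc z (0 : ℝ) : Fin (0 + 1) → ℝ) Q = (c₀ : ℝ)) →
      (∀ (z : Fin 0 → ℝ) (ϖ : ℝ), (∀ i, z i ∈ Icc (0 : ℝ) 1) → ϖ ∈ Ioo 0 ε →
        aeval (Fin.snoc z ϖ : Fin (0 + 1) → ℝ) Q ≠ 0) →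
      (∀ ϖ ∈ Ioo (0 : ℝ) ε, ∫ z in Set.pi Set.univ (fun _ : Fin 0 => Ioo (0 : ℝ) 1),
        aeval (Fin.snoc z ϖ : Fin (0 + 1) → ℝ) P / aeval (Fin.snoc z ϖ : Fin (0 + 1) → ℝ) Q = 0) →
      ∀ ϖ₀ : ℝ, IsAlgebraic ℚ ϖ₀ → ϖ₀ ∈ Ioo 0 ε →
      ∀ Φ : KZ.IntegralRep 0, Φ.IsTameCube →
        (∀ z ∈ KZ.cube 0, Φ.integrand z =
          aeval (Fin.snoc z ϖ₀ : Fin (0 + 1) → ℝ) P / aeval (Fin.snoc z ϖ₀ : Fin (0 + 1) → ℝ) Q) →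
        KZ.of Φ ∈ KZ.relations := by
  intro P Q ε _hε _hc₀ _hQ hvan ϖ₀ _halg hϖ₀ Φ hΦ hint
  -- the vanishing hypothesis at `ϖ₀` is the vanishing of the fibre integrand at the point `ℝ⁰`
  have h0 : aeval (Fin.snoc (default : Fin 0 → ℝ) ϖ₀ : Fin (0 + 1) → ℝ) P /
      aeval (Fin.snoc (default : Fin 0 → ℝ) ϖ₀ : Fin (0 + 1) → ℝ) Q = 0 := by
    have h := hvan ϖ₀ hϖ₀
    rwa [setIntegral_pi_univ_Ioo_fin_zero (fun z : Fin 0 → ℝ =>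
      aeval (Fin.snoc z ϖ₀ : Fin (0 + 1) → ℝ) P / aeval (Fin.snoc z ϖ₀ : Fin (0 + 1) → ℝ) Q)] at h
  -- hence `Φ.integrand` vanishes on `Φ.domain = KZ.cube 0`
  refine KZ.of_mem_relations_of_eqOn_zero Φ fun z hz => ?_
  rw [hΦ.domain_eq] at hz
  rw [Pi.zero_apply, hint z hz, Subsingleton.elim z default]
  exact h0

end Summit.KontsevichZagierPeriods.InverseLandau.TateFamilyKernel.Descent

end
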